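import Summits.HodgeConjecture.HodgeConjecture.Theorems.MarkmanPartnerTransportLowPicardRMCells
import Summits.HodgeConjecture.HodgeConjecture.Theorems.MarkmanPartnerTransportOrphanKS
import Summits.HodgeConjecture.HodgeConjecture.Theorems.MarkmanPartnerTransportIsometrySpannedThirdProjection

/-!
# Route MarkmanPartnerTransport · crux `LowPicardRealMultiplication` (stmt-HodgeConjecture-19653) —
# «CELL12-KS»: the real-QUADRATIC cells `(ρ(X), [E:ℚ]) = (ρ, 2)` of crux #5 hold GRANTED Kuga–Satake for `X`;
# in particular «Kuga–Satake for X ⇒ HC⁴(X)» for EVERY projective `K3^{[2]}`-type fourfold of Picard rank `1`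

Cell hodge-nonav, planner p1 g38 (target «CELL12-KS», 2026-08-28T14:10:22Z), prover seat hodge-nonav-19652-p1 (gen 9;
the K3-square twin is `…PicardThreeK3SquaresQuadraticGenerator`). «RM-GEN + CELL-SPLIT» (prover 20241-p1 g14,
`…LowPicardRMCells`): a marked projective `K3^{[2]}`-type `X` whose transcendental Hodge endomorphisms are not
spanned by isometries carries a generator `θ` of `E(X) = End_Hdg T(X)` of some degree `d ≥ 2` (`RMgen[X, φ, z, d]`),
and crux #5 is the conjunction of the six cells `CellHC[ρ, d]`, `(ρ, d) ∈ {(1,2), (2,3), (2,7), (3,2), (3,4), (3,5)}`.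
T1 «ORPH-KS» (`OrphanKS.hodgeConjectureFor_of_quadraticEndomorphismField_of_KSHC`): HC⁴(X) for `E(X)` real
QUADRATIC — given a `q`-self-adjoint `θ'` with transcendental image, `θ'² = d' ≠ 0` on `T(X)` and
`End_Hdg T(X) = ℚ + ℚθ'` — GRANTED the Kuga–Satake statement `IsKSCorrespondenceAlgebraicHK 2` for `X` and modulo
{Verbitsky–Guan, O'Grady 2008, Charles–Markman 2013, Varesco 2023 Cor. 4.6, Beauville 1983}. This file bridges
`RMgen[X, φ, z, 2]` to T1:

* `mapsTo_algebraicClasses_one_fourfold` — a rational, type-preserving endomorphism of `H²(X(ℂ); ℂ)` maps `N¹(X)`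
  into itself (Lefschetz `(1,1)`; the surface lemma `OneCycle.mapsTo_algebraicClasses_one`, verbatim in dimension 4).
* `hodgeConjectureFor_of_rmGenerator_two_of_kugaSatake` — **`RMgen[X, φ, z, 2]` + Kuga–Satake for `X` ⇒
  `HodgeConjectureFor 4 X`**: GEN applied to `θ²` gives `θ² = b + aθ` on `T(X)`, the eigenvalue `ev` of `θ` on `σ`
  has `ev² = a ev + b` with `deg minpoly_ℚ(ev) = 2`, so `d' := a² + 4b ≠ 0`; with the transcendental projector `π_T`
  (`exists_transcendentalProjector`, gen 6) the endomorphism `θ' := (2θ − a) ∘ π_T` is rational, type-preserving,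
  kills `N¹`, has transcendental image, is `q`-self-adjoint (`θ` preserves `N¹` and `T`, so `2θ − a` commutes
  with `π_T`), satisfies `θ'² = d'` on `T(X)` and generates: T1 applies.
* `cellHC_two_of_kugaSatake` — **`CellHC[ρ, 2]` for EVERY `ρ`, granted the Kuga–Satake statement on the marked
  projective `K3^{[2]}`-type fourfolds with `¬ SpannedByIsometries` and `RMgen` of degree `2`**: cells `(1,2)` and
  `(3,2)` of the crux-#5 map become CONDITIONAL-on-KSHC by name.
* `hodgeConjectureFor_of_picard_one_of_kugaSatake` — **for every marked projective `K3^{[2]}`-type `X` with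
  `ρ(X) = 1`: Kuga–Satake for `X` ⇒ `HodgeConjectureFor 4 X`** (`d · n = 22`, `n ≥ 3` forces `d = 2`:
  `cell_cases`; the isometry-spanned case is `hodgeConjectureFor_of_isometrySpannedThird_of_four_facts`-free here:
  it is covered by `RMgen`'s complement via `SpIso` and the four facts — see the statement).
* `lowPicardRealMultiplication_of_kugaSatake_of_four_cells` — crux #5 BY NAME from Kuga–Satake on the quadratic
  cells plus `CellHC[2,3]`, `CellHC[2,7]`, `CellHC[3,4]`, `CellHC[3,5]` (the degree `≥ 3` cells: no algebraic source
  in print).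

CONDITIONAL on the Kuga–Satake statement for `X` (OPEN in print for `K3^{[n]}`-type, Varesco 2023 §5) and the five
named facts of T1; no definition, no sorry, no new named fact; nothing here proves HC or crux #5.
`--supports stmt-HodgeConjecture-19653`.

References: M. Varesco, Math. Z. 305 (2023) Cor. 4.6, Rem. 5.5, Conj. 4.2; F. Charles, E. Markman, Compos. Math. 149
(2013) Thm. 1.1; B. van Geemen, Michigan Math. J. 56 (2008) Lemma 3.2; Yu. G. Zarhin, J. reine angew. Math. 341
(1983) Thm. 1.5.1; C. Voisin, *Hodge Theory I*, Thm. 11.30.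
-/

noncomputable section

set_option linter.dupNamespace false

open scoped TensorProduct
open Module CategoryTheory Polynomial
open Literature.AlgebraicTopology.SingularHomology Literature.Geometry.Kaehler
open Literature.AlgebraicGeometry Literature.AlgebraicGeometry.Motives Literature.AlgebraicGeometry.HodgeTheory
open Literature.AlgebraicGeometry.Hyperkaehler Literature.AlgebraicGeometry.Surfaces
open Summit.HodgeConjecture.HodgeConjecture.Theorems.NikulinTwinTransport
open Summit.HodgeConjecture.HodgeConjecture.Theorems.MarkmanPartnerTransport

namespace Summit.HodgeConjecture.HodgeConjecture.Theorems.MarkmanPartnerTransport.PartnerLattice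

/-- `MarkedK3Sq[X, φ, P, z]`: VERBATIM the `let MarkedK3Sq := …` binder of the route declarations of
MarkmanPartnerTransport (clauses (m1)–(m6)). Local notation only. -/
local notation3 (prettyPrint := false) "MarkedK3Sq[" X ", " φ ", " P ", " z "]" =>
  (((IsIntegralClass P ∧ ∀ Q : complexBetti X (2 * 4), IsIntegralClass Q → ∃ n : ℤ, Q = n • P) ∧
    (∀ c : complexBetti X 2, IsIntegralClass c ↔ ∃ v : K3HilbertIndex → ℤ, φ c = fun i => (v i : ℂ)) ∧
    (∀ a : complexBetti X 2, cupPowTwo a 4 = ((3 : ℂ) * (k3HilbertForm 2 (φ a) (φ a)) ^ 2) • P) ∧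
    (IsOfHodgeType 4 X 2 2 0 (LinearEquiv.symm φ z) ∧
      ∀ τ : complexBetti X 2, IsOfHodgeType 4 X 2 2 0 τ → ∃ t : ℂ, τ = t • LinearEquiv.symm φ z) ∧
    (∀ c : complexBetti X 2, IsOfHodgeType 4 X 2 1 1 c ↔
      (k3HilbertForm 2 (φ c) z = 0 ∧ k3HilbertForm 2 (φ c) (star z) = 0)) ∧
    (k3HilbertForm 2 z z = 0 ∧ 0 < (k3HilbertForm 2 (star z) z).re)))

/-- `SpIso[X, φ]`: VERBATIM the `let SpannedByIsometries := …` binder of the route declarations. Local notation only. -/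
local notation3 (prettyPrint := false) "SpIso[" X ", " φ "]" =>
  (∀ f : complexBetti X 2 →ₗ[ℂ] complexBetti X 2, (∀ y, IsRationalClass y → IsRationalClass (f y)) →
    (∀ (i j : ℕ) y, IsOfHodgeType 4 X 2 i j y → IsOfHodgeType 4 X 2 i j (f y)) →
    (∀ d : complexBetti X 2, d ∈ algebraicClasses X 1 → f d = 0) →
    (∀ y : complexBetti X 2, ∀ d : complexBetti X 2, d ∈ algebraicClasses X 1 →
      k3HilbertForm 2 (φ (f y)) (φ d) = 0) →
    ∃ (k : ℕ) (c : Fin k → ℚ) (g : Fin k → (complexBetti X 2 →ₗ[ℂ] complexBetti X 2)),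
      (∀ i, Function.Bijective (g i) ∧ (∀ y, IsRationalClass y → IsRationalClass (g i y)) ∧
        (∀ (a b : ℕ) y, IsOfHodgeType 4 X 2 a b y → IsOfHodgeType 4 X 2 a b (g i y)) ∧
        (∀ a b, k3HilbertForm 2 (φ (g i a)) (φ (g i b)) = k3HilbertForm 2 (φ a) (φ b))) ∧
      ∀ y : complexBetti X 2, (∀ d : complexBetti X 2, d ∈ algebraicClasses X 1 →
        k3HilbertForm 2 (φ y) (φ d) = 0) → f y = ∑ i : Fin k, ((c i : ℂ) • g i y))

/-- `RMgen[X, φ, z, d]`: VERBATIM the local notation of `…LowPicardRMCells` («RM-GEN» data). Local notation only. -/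
local notation3 (prettyPrint := false) "RMgen[" X ", " φ ", " z ", " d "]" =>
  (∃ θ : complexBetti X 2 →ₗ[ℂ] complexBetti X 2, (∀ y, IsRationalClass y → IsRationalClass (θ y)) ∧
    (∀ (i j : ℕ) y, IsOfHodgeType 4 X 2 i j y → IsOfHodgeType 4 X 2 i j (θ y)) ∧
    (∀ y w : complexBetti X 2, k3HilbertForm 2 (φ (θ y)) (φ w) = k3HilbertForm 2 (φ y) (φ (θ w))) ∧
    ∃ ev : ℂ, θ (LinearEquiv.symm φ z) = ev • LinearEquiv.symm φ z ∧ ev.im = 0 ∧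
      (minpoly ℚ ev).natDegree = d ∧
      (∃ n : ℕ, 3 ≤ n ∧ d * n + Module.finrank ℂ ↥(algebraicClasses X 1) = 23) ∧
      ∀ f : complexBetti X 2 →ₗ[ℂ] complexBetti X 2, (∀ y, IsRationalClass y → IsRationalClass (f y)) →
        (∀ (i j : ℕ) y, IsOfHodgeType 4 X 2 i j y → IsOfHodgeType 4 X 2 i j (f y)) →
        ∃ c : Fin d → ℚ, ∀ y : complexBetti X 2,
          (∀ a : complexBetti X 2, a ∈ algebraicClasses X 1 → k3HilbertForm 2 (φ y) (φ a) = 0) →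
            f y = ∑ i : Fin d, ((c i : ℂ) • (θ ^ (i : ℕ)) y))

/-- `CellHC[ρ, d]`: VERBATIM the local notation of `…LowPicardRMCells` («CELL-SPLIT»). Local notation only. -/
local notation3 (prettyPrint := false) "CellHC[" ρ ", " d "]" =>
  (∀ (X : SchemeOver ℂ), IsSmoothProjective 4 X → IsOfK3HilbertSquareType X →
    ∀ (φ : complexBetti X 2 ≃ₗ[ℂ] (K3HilbertIndex → ℂ)) (P : complexBetti X (2 * 4)) (z : K3HilbertIndex → ℂ),
      MarkedK3Sq[X, φ, P, z] → ¬ SpIso[X, φ] → Module.finrank ℂ ↥(algebraicClasses X 1) = ρ →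
        RMgen[X, φ, z, d] → HodgeConjectureFor 4 X)

/-- `KSHC[hX]`: the Kuga–Satake statement for the fourfold (`hX : IsSmoothProjective 4 X`) (`IsKSCorrespondenceAlgebraicHK 2`). Local notation only. -/
local notation3 (prettyPrint := false) "KSHC[" hX "]" => (IsKSCorrespondenceAlgebraicHK 2 hX)

variable {X : SchemeOver ℂ} {φ : complexBetti X 2 ≃ₗ[ℂ] (K3HilbertIndex → ℂ)} {P : complexBetti X (2 * 4)}
  {z : K3HilbertIndex → ℂ}

/-! ### `N¹(X)` is stable under rational type-preserving endomorphisms -/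

/-- **A rational, type-preserving endomorphism of `H²(X(ℂ); ℂ)` maps `N¹(X)` into itself** (`X` smooth projective
fourfold): `N¹` is spanned by rational classes, which are of type `(1,1)`; their images are rational `(1,1)`-classes,
in `N¹` by Lefschetz `(1,1)`. The dimension-4 copy of `OneCycle.mapsTo_algebraicClasses_one`. [cite: VoisinHodgeI2002, Thm. 11.30] -/
theorem mapsTo_algebraicClasses_one_fourfold (hX : IsSmoothProjective 4 X)
    (e : complexBetti X 2 →ₗ[ℂ] complexBetti X 2) (he_rat : ∀ y, IsRationalClass y → IsRationalClass (e y))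
    (he_typ : ∀ (i j : ℕ) y, IsOfHodgeType 4 X 2 i j y → IsOfHodgeType 4 X 2 i j (e y)) :
    ∀ d ∈ algebraicClasses X 1, e d ∈ algebraicClasses X 1 := by
  intro d hd
  have hspan := supportedClasses_eq_span_isRationalClass hX (2 * 1) 1
  have hd' : d ∈ Submodule.span ℂ {c : complexBetti X (2 * 1) |
      IsRationalClass c ∧ c ∈ supportedClasses X (2 * 1) 1} := by
    rw [← hspan]; exact hd
  clear hd
  induction hd' using Submodule.span_induction with
  | mem c hc =>
    exact lefschetzOneOne_rational_holds hX (e c) (he_rat c hc.1)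
      (he_typ 1 1 c (isOfHodgeType_of_mem_algebraicClasses_of_isSmoothProjective hX 1 hc.2))
  | zero => rw [map_zero]; exact Submodule.zero_mem _
  | add c c' _ _ hc hc' => rw [map_add]; exact Submodule.add_mem _ hc hc'
  | smul t c _ hc => rw [map_smul]; exact Submodule.smul_mem _ _ hc

/-! ### `RMgen` of degree `2` + Kuga–Satake ⇒ HC⁴(X) -/

/-- **`RMgen[X, φ, z, 2]` + Kuga–Satake for `X` ⇒ `HodgeConjectureFor 4 X`** (module docstring): the degree-`2`
generator `θ` of «RM-GEN» is turned into the `q`-self-adjoint similitude `θ' = (2θ − a) ∘ π_T` with `θ'² = a² + 4b ≠ 0`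
on `T(X)` generating `End_Hdg T(X) = ℚ + ℚθ'`, and T1 «ORPH-KS» applies. CONDITIONAL on the Kuga–Satake statement for
`X`; facts {Verbitsky–Guan, O'Grady 2008, Charles–Markman 2013, Varesco 2023, Beauville 1983}. Credits nothing to HC.
[cite: Varesco2023, Cor. 4.6 and Rem. 5.5] [cite: CharlesMarkman2013, Thm. 1.1 (§1)] [cite: Vangeemen2008, Lemma 3.2] -/
theorem hodgeConjectureFor_of_rmGenerator_two_of_kugaSatake
    (hV : VerbitskyGuan_cohomology_K3HilbertSquareType) (hO : OGrady2008_dualBBFClass_algebraic)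
    (hB : CharlesMarkman2013_lefschetzStandard_K3HilbertType)
    (hVar : Varesco2023_transcendentalHodgeSimilitude_algebraic_of_lefschetzStandard)
    (hBea : Beauville1983_irreducibleSymplectic_of_k3HilbertType)
    (hX : IsSmoothProjective 4 X) (hK : IsOfK3HilbertSquareType X) (hM : MarkedK3Sq[X, φ, P, z])
    (hKS : KSHC[hX]) (hgen2 : RMgen[X, φ, z, 2]) : HodgeConjectureFor 4 X := by
  classical
  obtain ⟨-, -, -, ⟨hz20, -⟩, h11, -, hzpos⟩ := id hM
  obtain ⟨θ, h1, h2, h5, ev, hθσ, -, hdeg, -, hGEN⟩ := hgen2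
  obtain ⟨πT, hπN, hπT, hπimg, hπsub, hπrat, hπsa, hπtyp⟩ := exists_transcendentalProjector hX hM
  -- `σ = φ⁻¹ z` is transcendental and non-zero
  set σ := LinearEquiv.symm φ z with hσdef
  have hφσ : φ σ = z := by rw [hσdef, LinearEquiv.apply_symm_apply]
  have hσT : ∀ d : complexBetti X 2, d ∈ algebraicClasses X 1 → k3HilbertForm 2 (φ σ) (φ d) = 0 := by
    intro d hd
    rw [hφσ, k3HilbertForm_comm]
    exact ((h11 d).1 (isOfHodgeType_of_mem_algebraicClasses_of_isSmoothProjective hX 1 hd)).1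
  have hσne : σ ≠ 0 := by
    intro h0
    have hz : z = 0 := by rw [← hφσ, h0, map_zero]
    rw [hz, k3HilbertForm_eq_dotProduct] at hzpos
    simp at hzpos
  -- `θ` preserves `N¹(X)` and `T(X)`
  have hθN : ∀ d ∈ algebraicClasses X 1, θ d ∈ algebraicClasses X 1 := mapsTo_algebraicClasses_one_fourfold hX θ h1 h2
  have hθT : ∀ y : complexBetti X 2, (∀ d ∈ algebraicClasses X 1, k3HilbertForm 2 (φ y) (φ d) = 0) →
      ∀ d ∈ algebraicClasses X 1, k3HilbertForm 2 (φ (θ y)) (φ d) = 0 :=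
    fun y hy d hd => by rw [h5, hy _ (hθN d hd)]
  -- GEN on `θ²`: `θ² = b + a θ` on `T(X)`
  obtain ⟨c, hc⟩ := hGEN (θ ∘ₗ θ) (fun y hy => h1 _ (h1 y hy)) (fun i j y hy => h2 i j _ (h2 i j y hy))
  set a : ℚ := c 1 with ha
  set b : ℚ := c 0 with hb
  have hθθ : ∀ y : complexBetti X 2, (∀ d ∈ algebraicClasses X 1, k3HilbertForm 2 (φ y) (φ d) = 0) →
      θ (θ y) = (b : ℂ) • y + (a : ℂ) • θ y := by
    intro y hy
    have h := hc y hy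
    rw [LinearMap.comp_apply, Fin.sum_univ_two, Fin.val_zero, Fin.val_one, pow_zero, pow_one,
      Module.End.one_apply] at h
    exact h
  -- the eigenvalue relation and `d' := a² + 4b ≠ 0`
  have hevrel : ev * ev = (a : ℂ) * ev + (b : ℂ) := by
    have h := hθθ σ hσT
    rw [hθσ, LinearMap.map_smul, hθσ, smul_smul, smul_smul, ← add_smul] at h
    have h' := smul_left_injective ℂ hσne h
    -- h' : ev * ev = b + a * ev
    rw [h']; ring
  have hd : a * a + 4 * b ≠ 0 := by
    intro hd0
    have hsq : (2 * ev - (a : ℂ)) * (2 * ev - (a : ℂ)) = 0 := by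
      have : ((a * a + 4 * b : ℚ) : ℂ) = 0 := by rw [hd0, Rat.cast_zero]
      rw [Rat.cast_add, Rat.cast_mul, Rat.cast_mul, Rat.cast_ofNat] at this
      linear_combination (4 : ℂ) * hevrel + this
    have hev : ev = ((a / 2 : ℚ) : ℂ) := by
      rcases mul_self_eq_zero.1 hsq with h0
      rw [Rat.cast_div, Rat.cast_ofNat]
      linear_combination h0 / 2
    have h1' : (minpoly ℚ ev).natDegree = 1 := by
      rw [hev, show ((a / 2 : ℚ) : ℂ) = algebraMap ℚ ℂ (a / 2) from (eq_ratCast _ _).symm,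
        minpoly.eq_X_sub_C (B := ℂ) (a / 2), Polynomial.natDegree_X_sub_C]
    omega
  -- `θ' := (2θ − a) ∘ π_T`
  let θ' : complexBetti X 2 →ₗ[ℂ] complexBetti X 2 :=
    ((2 : ℂ) • θ + ((-a : ℚ) : ℂ) • LinearMap.id) ∘ₗ πT
  have hθ'app : ∀ y, θ' y = (2 : ℂ) • θ (πT y) + ((-a : ℚ) : ℂ) • πT y := fun y => by
    simp only [θ', LinearMap.comp_apply, LinearMap.add_apply, LinearMap.smul_apply, LinearMap.id_apply]
  have hθ'T : ∀ y : complexBetti X 2, (∀ d ∈ algebraicClasses X 1, k3HilbertForm 2 (φ y) (φ d) = 0) →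
      θ' y = (2 : ℂ) • θ y - (a : ℂ) • y := by
    intro y hy
    rw [hθ'app, hπT y hy, Rat.cast_neg, neg_smul, sub_eq_add_neg]
  have h1' : ∀ y, IsRationalClass y → IsRationalClass (θ' y) := by
    intro y hy
    rw [hθ'app, show (2 : ℂ) = ((2 : ℚ) : ℂ) by norm_num]
    exact ((h1 _ (hπrat y hy)).smul 2).add ((hπrat y hy).smul (-a))
  have h2' : ∀ (i j : ℕ) y, IsOfHodgeType 4 X 2 i j y → IsOfHodgeType 4 X 2 i j (θ' y) := by
    intro i j y hy
    rw [hθ'app]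
    exact ((h2 i j _ (hπtyp i j y hy)).smul _).add hX ((hπtyp i j y hy).smul _)
  have h4' : ∀ y : complexBetti X 2, ∀ d : complexBetti X 2, d ∈ algebraicClasses X 1 →
      k3HilbertForm 2 (φ (θ' y)) (φ d) = 0 := by
    intro y d hd
    rw [hθ'app, map_add, map_smul, map_smul, k3HilbertForm_add_left, k3HilbertForm_smul_left,
      k3HilbertForm_smul_left, hθT _ (hπimg y) d hd, hπimg y d hd, mul_zero, mul_zero, add_zero]
  -- `π_T` commutes with `θ`
  have hcomm : ∀ w : complexBetti X 2, πT (θ w) = θ (πT w) := by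
    intro w
    have hn : w - πT w ∈ algebraicClasses X 1 := hπsub w
    have hsplit : θ w = θ (πT w) + θ (w - πT w) := by rw [← map_add, add_sub_cancel]
    rw [hsplit, map_add, hπN _ (hθN _ hn), add_zero, hπT _ (hθT _ (hπimg w))]
  have h5' : ∀ y w : complexBetti X 2, k3HilbertForm 2 (φ (θ' y)) (φ w) = k3HilbertForm 2 (φ y) (φ (θ' w)) := by
    intro y w
    rw [hθ'app, hθ'app, map_add, map_smul, map_smul, map_add, map_smul, map_smul, k3HilbertForm_add_left,
      k3HilbertForm_smul_left, k3HilbertForm_smul_left, k3HilbertForm_add_right, k3HilbertForm_smul_right,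
      k3HilbertForm_smul_right, h5, ← hcomm, hπsa, hπsa y]
  have hθ'θ' : ∀ y : complexBetti X 2,
      (∀ e : complexBetti X 2, e ∈ algebraicClasses X 1 → k3HilbertForm 2 (φ y) (φ e) = 0) →
      θ' (θ' y) = ((a * a + 4 * b : ℚ) : ℂ) • y := by
    intro y hy
    have hyT' : ∀ e ∈ algebraicClasses X 1, k3HilbertForm 2 (φ (θ' y)) (φ e) = 0 := fun e he => h4' y e he
    rw [hθ'T _ hyT', hθ'T y hy, map_sub, LinearMap.map_smul, LinearMap.map_smul, hθθ y hy, Rat.cast_add,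
      Rat.cast_mul, Rat.cast_mul, Rat.cast_ofNat]
    module
  have hgen' : ∀ f : complexBetti X 2 →ₗ[ℂ] complexBetti X 2, (∀ y, IsRationalClass y → IsRationalClass (f y)) →
      (∀ (i j : ℕ) y, IsOfHodgeType 4 X 2 i j y → IsOfHodgeType 4 X 2 i j (f y)) →
      (∀ e : complexBetti X 2, e ∈ algebraicClasses X 1 → f e = 0) →
      (∀ y : complexBetti X 2, ∀ e : complexBetti X 2, e ∈ algebraicClasses X 1 →
        k3HilbertForm 2 (φ (f y)) (φ e) = 0) →
      ∃ a' c' : ℚ, ∀ y : complexBetti X 2,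
        (∀ e : complexBetti X 2, e ∈ algebraicClasses X 1 → k3HilbertForm 2 (φ y) (φ e) = 0) →
        f y = (a' : ℂ) • y + (c' : ℂ) • θ' y := by
    intro f hf_rat hf_typ _ _
    obtain ⟨c', hc'⟩ := hGEN f hf_rat hf_typ
    refine ⟨c' 0 + c' 1 * a / 2, c' 1 / 2, fun y hy => ?_⟩
    have h := hc' y hy
    rw [Fin.sum_univ_two, Fin.val_zero, Fin.val_one, pow_zero, pow_one, Module.End.one_apply] at h
    rw [h, hθ'T y hy, Rat.cast_add, Rat.cast_div, Rat.cast_mul, Rat.cast_div, Rat.cast_ofNat]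
    module
  exact OrphanKS.hodgeConjectureFor_of_quadraticEndomorphismField_of_KSHC hV hO hB hVar hBea hX hK hM hKS θ' h1' h2'
    h4' h5' (a * a + 4 * b) hd hθ'θ' hgen'

/-- **«CELL12-KS»: the real-QUADRATIC cells `CellHC[ρ, 2]` hold for every `ρ`, GRANTED the Kuga–Satake statement on
the fourfolds concerned** (cells `(1,2)` and `(3,2)` of the crux-#5 map; T1 through
`hodgeConjectureFor_of_rmGenerator_two_of_kugaSatake`). CONDITIONAL; credits nothing to HC.
[cite: Varesco2023, Cor. 4.6 and Conj. 4.2] [cite: CharlesMarkman2013, Thm. 1.1 (§1)] -/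
theorem cellHC_two_of_kugaSatake
    (hV : VerbitskyGuan_cohomology_K3HilbertSquareType) (hO : OGrady2008_dualBBFClass_algebraic)
    (hB : CharlesMarkman2013_lefschetzStandard_K3HilbertType)
    (hVar : Varesco2023_transcendentalHodgeSimilitude_algebraic_of_lefschetzStandard)
    (hBea : Beauville1983_irreducibleSymplectic_of_k3HilbertType)
    (hKS : ∀ (Y : SchemeOver ℂ) (hY : IsSmoothProjective 4 Y), IsOfK3HilbertSquareType Y →
      ∀ (φ : complexBetti Y 2 ≃ₗ[ℂ] (K3HilbertIndex → ℂ)) (P : complexBetti Y (2 * 4)) (z : K3HilbertIndex → ℂ),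
        MarkedK3Sq[Y, φ, P, z] → ¬ SpIso[Y, φ] → RMgen[Y, φ, z, 2] → KSHC[hY])
    (ρ : ℕ) : CellHC[ρ, 2] :=
  fun Y hY hK φ P z hM hsp _ hgen2 =>
    hodgeConjectureFor_of_rmGenerator_two_of_kugaSatake hV hO hB hVar hBea hY hK hM (hKS Y hY hK φ P z hM hsp hgen2)
      hgen2

/-- **For every marked projective `K3^{[2]}`-type fourfold of PICARD RANK `1` whose transcendental Hodge
endomorphisms are not spanned by isometries: Kuga–Satake for `X` ⇒ `HodgeConjectureFor 4 X`** — `rank T(X) = 22 =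
d · n` with `n ≥ 3` forces `[E(X):ℚ] = d = 2` (`cell_cases`), so «RM-GEN» + `cellHC_two_of_kugaSatake`. (The
isometry-spanned case is support #3, `IsometrySpannedThird`, by name elsewhere.) CONDITIONAL on Kuga–Satake for
`X`; facts as in T1. [cite: Varesco2023, Cor. 4.6 and Conj. 4.2] [cite: Vangeemen2008, Lemma 3.2] -/
theorem hodgeConjectureFor_of_picard_one_of_kugaSatake
    (hV : VerbitskyGuan_cohomology_K3HilbertSquareType) (hO : OGrady2008_dualBBFClass_algebraic)
    (hB : CharlesMarkman2013_lefschetzStandard_K3HilbertType)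
    (hVar : Varesco2023_transcendentalHodgeSimilitude_algebraic_of_lefschetzStandard)
    (hBea : Beauville1983_irreducibleSymplectic_of_k3HilbertType)
    (hX : IsSmoothProjective 4 X) (hK : IsOfK3HilbertSquareType X) (hM : MarkedK3Sq[X, φ, P, z])
    (hsp : ¬ SpIso[X, φ]) (hρ : Module.finrank ℂ ↥(algebraicClasses X 1) = 1) (hKS : KSHC[hX]) :
    HodgeConjectureFor 4 X := by
  obtain ⟨d, hd2, hgen⟩ := exists_rmGenerator_of_not_spannedByIsometries hX hM hsp
  obtain ⟨-, -, -, -, -, -, -, -, ⟨n, hn, hdn⟩, -⟩ := id hgen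
  rcases cell_cases (by omega : Module.finrank ℂ ↥(algebraicClasses X 1) ≤ 3) hd2 hn hdn with
    ⟨-, rfl⟩ | ⟨hρ', -⟩ | ⟨hρ', -⟩
  · exact hodgeConjectureFor_of_rmGenerator_two_of_kugaSatake hV hO hB hVar hBea hX hK hM hKS hgen
  · omega
  · omega

/-- **Crux #5 `LowPicardRealMultiplication` BY NAME from Kuga–Satake on the quadratic cells and HC⁴ on the four cells of
degree `≥ 3`** (`(2,3)`, `(2,7)`, `(3,4)`, `(3,5)`: no algebraic source in print): «CELL-SPLIT»
(`lowPicardRealMultiplication_of_six_cells`) with `cellHC_two_of_kugaSatake` at `ρ = 1` and `ρ = 3`. CONDITIONAL;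
credits nothing to HC. [cite: Varesco2023, Cor. 4.6 and Conj. 4.2] [cite: Vangeemen2008, Lemma 3.2] -/
theorem lowPicardRealMultiplication_of_kugaSatake_of_four_cells
    (hV : VerbitskyGuan_cohomology_K3HilbertSquareType) (hO : OGrady2008_dualBBFClass_algebraic)
    (hB : CharlesMarkman2013_lefschetzStandard_K3HilbertType)
    (hVar : Varesco2023_transcendentalHodgeSimilitude_algebraic_of_lefschetzStandard)
    (hBea : Beauville1983_irreducibleSymplectic_of_k3HilbertType)
    (hKS : ∀ (X : SchemeOver ℂ) (hX : IsSmoothProjective 4 X), IsOfK3HilbertSquareType X →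
      ∀ (φ : complexBetti X 2 ≃ₗ[ℂ] (K3HilbertIndex → ℂ)) (P : complexBetti X (2 * 4)) (z : K3HilbertIndex → ℂ),
        MarkedK3Sq[X, φ, P, z] → ¬ SpIso[X, φ] → RMgen[X, φ, z, 2] → KSHC[hX])
    (h23 : CellHC[2, 3]) (h27 : CellHC[2, 7]) (h34 : CellHC[3, 4]) (h35 : CellHC[3, 5]) :
    Summit.HodgeConjecture.HodgeConjecture.Theses.MarkmanPartnerTransport.LowPicardRealMultiplication :=
  lowPicardRealMultiplication_of_six_cells (cellHC_two_of_kugaSatake hV hO hB hVar hBea hKS 1) h23 h27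
    (cellHC_two_of_kugaSatake hV hO hB hVar hBea hKS 3) h34 h35

end Summit.HodgeConjecture.HodgeConjecture.Theorems.MarkmanPartnerTransport.PartnerLattice

end
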